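/-
Copyright (c) 2026 the pub-hodgecm-mathlib formalisation cell (harness21).  Prover seat hodgecm-mathlib-R90-C131-p02 (g0) (R90-TF S4 hand lent to L1
by CHAIR VALVE WORD W4), Track B «K2-LIT», hLiu418 = `stmt-HodgeConjecture-24832`; K1-a♮ line lead K2E5-p16 (g8) DESK NAME 01:27Z «(iii-b-3) FILE 1».
THEOREMS ONLY (no `def`, no instance, no notation, no named-fact hypothesis, no `sorry`); lane `--supports stmt-HodgeConjecture-24832 --as helper`.
-/
import Summits.HodgeConjecture.HodgeConjecture.Theorems.K2LiuArchTwistedIntertwiningKFiniteSwap   -- ★ p863633 (brings `hasDerivAt_exp_smul_entry_at`, `conjTranspose_exp_mul_J_mul_exp`, tube cocycle)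
import Summits.HodgeConjecture.HodgeConjecture.Theorems.K2LiuHermTwoGammaDefs                  -- ★ `hermTwo`, `posDef_hermTwo_iff` (the weight coordinates)
import Mathlib.Analysis.InnerProductSpace.Calculus
import HarnessLib

/-!
# Crux `HLiu418`, (Φ-S1) road B, (iii-b-3) FILE 1: RAY CALCULUS OF THE POINT DATA — along `t ↦ g·exp(tX)` (`g ∈ U(J)`, `X ∈ 𝔲(J)`) every datum of the
# explicit scalar-type arch letter (★ p863574 ∕ ★ p864004) is real-differentiable in `t` on all of `ℝ`

Cell `hodgecm-mathlib`, crux item hLiu418 = `stmt-HodgeConjecture-24832` (helper lane, count-neutral).  The non-scalar `K_w`-types of the twisted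
archimedean block are iterated RAY DERIVATIVES IN THE POINT of the scalar block (★ p863633: `B(D_X F)(s,g) = d/dt|₀ B(F)(s, g·exp(tX))`), and the
scalar block is ★ p864004's EXPLICIT letter `Ac s g` — a product of `det d(g)^{−k}`, `‖det d(g)‖^{k−2s−2}`, `e(τ(T·U(g)))`, `(π/p(g))e^{−p(g)πt}`,
`(1/q′(g))^{2s}`, `Γ`-factors and `Φ_N(1+k/2, 1−k/2, p(g), s)`, where `d(g) = denom g (i1)`, `U(g) + iV(g) = moeb g (i1)`, and `(p, w, q)(g)` are the
`hermTwo`-coordinates of the weight `aᴴ(2V(g))a`, `q′ = q − |w|²/p`.  THIS FILE: along the ray `g_t = g·exp(tX)` (which stays in `U(J)`), each of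
these point data is `Differentiable ℝ` in `t` (everywhere), and `p(g_t) > 0`, `q′(g_t) > 0`, `det d(g_t) ≠ 0` — the inputs of FILE 2's product rule
(`d/dt Ac s g_t` explicit and visibly holomorphic in `s`; the `Φ_N` factor by ★ p863550 (d) ∘ chain rule).
* §1 entries of `g_t`, of `denom`, `num`, `det denom`, `(denom)⁻¹` (2×2 adjugate), `moeb`, and of conjugate-transposes;
* §2 the weight: entries of `U, V, aᴴ(2V)a`; `p, w, q, |w|², q′`; positivity of `p, q′`; §3 `‖det d(g_t)‖`; §4 the bundle **`differentiable_pointData_mul_exp`**.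

HONEST LABEL: calculus letters; closes no socket.  HC_CM is proved only modulo the 7 printed citations (2 remaining named inputs: hLiu418 =
`stmt-HodgeConjecture-24832`, h413 = `stmt-HodgeConjecture-24833`) until rung 0 closes.  REL ≠ ★ ≠ BUILT.

## References
* [Knapp1986] A. W. Knapp, *Representation Theory of Semisimple Groups*, Princeton (1986), Ch. I §1, Ch. VIII §3.
* [Shimura1997] G. Shimura, *Euler Products and Eisenstein Series*, CBMS 93 (1997), §5.1, §16.4.
-/

set_option autoImplicit false
set_option linter.dupNamespace false

noncomputable section

open Complex Matrix NormedSpace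
open scoped ComplexConjugate ComplexOrder

namespace Summit.HodgeConjecture.HodgeConjecture.Cruxes.HLiu418.K2LiuArchPointRayCalculus

open Literature.NumberTheory.ModularForms.SiegelUpperHalfSpace (num denom moeb num_def denom_def moeb_def)
open Summit.HodgeConjecture.HodgeConjecture.Cruxes.HLiu418.K2LiuHermTwoGammaDefs
open Summit.HodgeConjecture.HodgeConjecture.Cruxes.HLiu418.K2LiuHermTwoEtaDefs
open Summit.HodgeConjecture.HodgeConjecture.Cruxes.HLiu418.K2LiuHermitianTubeCocycle (mul_mem_UJ isUnit_det_denom posDef_im_moeb posDef_im_I_smul_one)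
open Summit.HodgeConjecture.HodgeConjecture.Cruxes.HLiu418.K2LiuLieRayDifferentiability (conjTranspose_exp_mul_J_mul_exp)
open Summit.HodgeConjecture.HodgeConjecture.Cruxes.HLiu418.K2LiuArchIntertwiningLieDerivativeExp (hasDerivAt_exp_smul_entry_at)

/-! ## §1 Entries along the ray -/

/-- The entries of `t ↦ exp(tX)` are differentiable on `ℝ`. [Knapp1986, Ch. I §1] -/
theorem differentiable_exp_smul_entry (X : Matrix (Fin 2 ⊕ Fin 2) (Fin 2 ⊕ Fin 2) ℂ) (i j : Fin 2 ⊕ Fin 2) :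
    Differentiable ℝ (fun t : ℝ => NormedSpace.exp (t • X) i j) :=
  fun t => (hasDerivAt_exp_smul_entry_at X t i j).differentiableAt

/-- The entries of the ray `t ↦ g·exp(tX)` are differentiable on `ℝ`. [Knapp1986, Ch. I §1] -/
theorem differentiable_mul_exp_entry (g X : Matrix (Fin 2 ⊕ Fin 2) (Fin 2 ⊕ Fin 2) ℂ) (i j : Fin 2 ⊕ Fin 2) :
    Differentiable ℝ (fun t : ℝ => (g * NormedSpace.exp (t • X)) i j) := by
  have h : (fun t : ℝ => (g * NormedSpace.exp (t • X)) i j) = fun t => ∑ q, g i q * NormedSpace.exp (t • X) q j := by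
    funext t; rw [Matrix.mul_apply]
  rw [h]
  exact Differentiable.fun_sum fun q _ => (differentiable_const _).mul (differentiable_exp_smul_entry X q j)

/-- The entries of `denom (·) (i1) = i·(·)₂₁ + (·)₂₂` along the ray are differentiable. [Shimura1997, §5.1] -/
theorem differentiable_denom_entry (g X : Matrix (Fin 2 ⊕ Fin 2) (Fin 2 ⊕ Fin 2) ℂ) (i j : Fin 2) :
    Differentiable ℝ (fun t : ℝ => denom (g * NormedSpace.exp (t • X)) (I • (1 : Matrix (Fin 2) (Fin 2) ℂ)) i j) := by
  have h : ∀ P : Matrix (Fin 2 ⊕ Fin 2) (Fin 2 ⊕ Fin 2) ℂ, denom P (I • (1 : Matrix (Fin 2) (Fin 2) ℂ)) i j =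
      I * P (Sum.inr i) (Sum.inl j) + P (Sum.inr i) (Sum.inr j) := fun P => by
    rw [denom_def, Matrix.mul_smul, Matrix.mul_one]
    simp [Matrix.toBlocks₂₁, Matrix.toBlocks₂₂]
  simp_rw [h]
  exact ((differentiable_const _).mul (differentiable_mul_exp_entry g X _ _)).add (differentiable_mul_exp_entry g X _ _)

/-- The entries of `num (·) (i1) = i·(·)₁₁ + (·)₁₂` along the ray are differentiable. [Shimura1997, §5.1] -/
theorem differentiable_num_entry (g X : Matrix (Fin 2 ⊕ Fin 2) (Fin 2 ⊕ Fin 2) ℂ) (i j : Fin 2) :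
    Differentiable ℝ (fun t : ℝ => num (g * NormedSpace.exp (t • X)) (I • (1 : Matrix (Fin 2) (Fin 2) ℂ)) i j) := by
  have h : ∀ P : Matrix (Fin 2 ⊕ Fin 2) (Fin 2 ⊕ Fin 2) ℂ, num P (I • (1 : Matrix (Fin 2) (Fin 2) ℂ)) i j =
      I * P (Sum.inl i) (Sum.inl j) + P (Sum.inl i) (Sum.inr j) := fun P => by
    rw [num_def, Matrix.mul_smul, Matrix.mul_one]
    simp [Matrix.toBlocks₁₁, Matrix.toBlocks₁₂]
  simp_rw [h]
  exact ((differentiable_const _).mul (differentiable_mul_exp_entry g X _ _)).add (differentiable_mul_exp_entry g X _ _)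

/-- `det denom` along the ray is differentiable (2×2 determinant). [Shimura1997, §5.6] -/
theorem differentiable_det_denom (g X : Matrix (Fin 2 ⊕ Fin 2) (Fin 2 ⊕ Fin 2) ℂ) :
    Differentiable ℝ (fun t : ℝ => (denom (g * NormedSpace.exp (t • X)) (I • (1 : Matrix (Fin 2) (Fin 2) ℂ))).det) := by
  simp_rw [Matrix.det_fin_two]
  exact ((differentiable_denom_entry g X 0 0).mul (differentiable_denom_entry g X 1 1)).sub
    ((differentiable_denom_entry g X 0 1).mul (differentiable_denom_entry g X 1 0))

/-- Along the ray from `g ∈ U(J)` in a direction `X ∈ 𝔲(J)` every point is in `U(J)`, so `det denom ≠ 0` there. [Knapp1986, Ch. I §1] -/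
theorem det_denom_mul_exp_ne_zero {g X : Matrix (Fin 2 ⊕ Fin 2) (Fin 2 ⊕ Fin 2) ℂ} (hg : gᴴ * Matrix.J (Fin 2) ℂ * g = Matrix.J (Fin 2) ℂ)
    (hX : Xᴴ * Matrix.J (Fin 2) ℂ + Matrix.J (Fin 2) ℂ * X = 0) (t : ℝ) :
    (denom (g * NormedSpace.exp (t • X)) (I • (1 : Matrix (Fin 2) (Fin 2) ℂ))).det ≠ 0 :=
  (isUnit_det_denom (mul_mem_UJ hg (conjTranspose_exp_mul_J_mul_exp hX t)) posDef_im_I_smul_one).ne_zero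

/-- The entries of `(denom)⁻¹` along the ray are differentiable (`A⁻¹ = (det A)⁻¹ • adj A`, 2×2 adjugate). [Shimura1997, §5.1] -/
theorem differentiable_inv_denom_entry {g X : Matrix (Fin 2 ⊕ Fin 2) (Fin 2 ⊕ Fin 2) ℂ} (hg : gᴴ * Matrix.J (Fin 2) ℂ * g = Matrix.J (Fin 2) ℂ)
    (hX : Xᴴ * Matrix.J (Fin 2) ℂ + Matrix.J (Fin 2) ℂ * X = 0) (i j : Fin 2) :
    Differentiable ℝ (fun t : ℝ => (denom (g * NormedSpace.exp (t • X)) (I • (1 : Matrix (Fin 2) (Fin 2) ℂ)))⁻¹ i j) := by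
  have e00 : ∀ A : Matrix (Fin 2) (Fin 2) ℂ, A.adjugate 0 0 = A 1 1 := fun A => by
    rw [Matrix.adjugate_fin_two]; simp
  have e01 : ∀ A : Matrix (Fin 2) (Fin 2) ℂ, A.adjugate 0 1 = -A 0 1 := fun A => by
    rw [Matrix.adjugate_fin_two]; simp
  have e10 : ∀ A : Matrix (Fin 2) (Fin 2) ℂ, A.adjugate 1 0 = -A 1 0 := fun A => by
    rw [Matrix.adjugate_fin_two]; simp
  have e11 : ∀ A : Matrix (Fin 2) (Fin 2) ℂ, A.adjugate 1 1 = A 0 0 := fun A => by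
    rw [Matrix.adjugate_fin_two]; simp
  have hadj : ∀ i j : Fin 2, Differentiable ℝ (fun t : ℝ => (denom (g * NormedSpace.exp (t • X)) (I • (1 : Matrix (Fin 2) (Fin 2) ℂ))).adjugate i j) := by
    intro i j
    fin_cases i <;> fin_cases j
    · simp only [Fin.zero_eta, Fin.isValue, e00]
      exact differentiable_denom_entry g X 1 1
    · simp only [Fin.zero_eta, Fin.mk_one, Fin.isValue, e01]
      exact (differentiable_denom_entry g X 0 1).neg
    · simp only [Fin.zero_eta, Fin.mk_one, Fin.isValue, e10]
      exact (differentiable_denom_entry g X 1 0).neg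
    · simp only [Fin.mk_one, Fin.isValue, e11]
      exact differentiable_denom_entry g X 0 0
  have hinv : Differentiable ℝ (fun t : ℝ => ((denom (g * NormedSpace.exp (t • X)) (I • (1 : Matrix (Fin 2) (Fin 2) ℂ))).det)⁻¹) := fun t =>
    ((differentiableAt_inv (𝕜 := ℂ) (det_denom_mul_exp_ne_zero hg hX t)).restrictScalars ℝ).comp t (differentiable_det_denom g X t)
  have h : (fun t : ℝ => (denom (g * NormedSpace.exp (t • X)) (I • (1 : Matrix (Fin 2) (Fin 2) ℂ)))⁻¹ i j) =
      fun t => ((denom (g * NormedSpace.exp (t • X)) (I • (1 : Matrix (Fin 2) (Fin 2) ℂ))).det)⁻¹ *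
        (denom (g * NormedSpace.exp (t • X)) (I • (1 : Matrix (Fin 2) (Fin 2) ℂ))).adjugate i j := by
    funext t
    rw [Matrix.inv_def, Ring.inverse_eq_inv', Matrix.smul_apply, smul_eq_mul]
  rw [h]
  exact hinv.mul (hadj i j)

/-- The entries of `moeb (·) (i1) = num · denom⁻¹` along the ray are differentiable. [Shimura1997, §5.1] -/
theorem differentiable_moeb_entry {g X : Matrix (Fin 2 ⊕ Fin 2) (Fin 2 ⊕ Fin 2) ℂ} (hg : gᴴ * Matrix.J (Fin 2) ℂ * g = Matrix.J (Fin 2) ℂ)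
    (hX : Xᴴ * Matrix.J (Fin 2) ℂ + Matrix.J (Fin 2) ℂ * X = 0) (i j : Fin 2) :
    Differentiable ℝ (fun t : ℝ => moeb (g * NormedSpace.exp (t • X)) (I • (1 : Matrix (Fin 2) (Fin 2) ℂ)) i j) := by
  have h : (fun t : ℝ => moeb (g * NormedSpace.exp (t • X)) (I • (1 : Matrix (Fin 2) (Fin 2) ℂ)) i j) =
      fun t => ∑ q, num (g * NormedSpace.exp (t • X)) (I • (1 : Matrix (Fin 2) (Fin 2) ℂ)) i q * (denom (g * NormedSpace.exp (t • X)) (I • (1 : Matrix (Fin 2) (Fin 2) ℂ)))⁻¹ q j := by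
    funext t; rw [moeb_def, Matrix.mul_apply]
  rw [h]
  exact Differentiable.fun_sum fun q _ => (differentiable_num_entry g X i q).mul (differentiable_inv_denom_entry hg hX q j)

/-- The entries of the conjugate transpose `(moeb …)ᴴ` along the ray are differentiable. [folklore] -/
theorem differentiable_moeb_conjTranspose_entry {g X : Matrix (Fin 2 ⊕ Fin 2) (Fin 2 ⊕ Fin 2) ℂ} (hg : gᴴ * Matrix.J (Fin 2) ℂ * g = Matrix.J (Fin 2) ℂ)
    (hX : Xᴴ * Matrix.J (Fin 2) ℂ + Matrix.J (Fin 2) ℂ * X = 0) (i j : Fin 2) :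
    Differentiable ℝ (fun t : ℝ => (moeb (g * NormedSpace.exp (t • X)) (I • (1 : Matrix (Fin 2) (Fin 2) ℂ)))ᴴ i j) := by
  simp_rw [Matrix.conjTranspose_apply]
  exact (Complex.conjCLE.differentiable).comp (differentiable_moeb_entry hg hX j i)

/-! ## §2 The weight `aᴴ(2V)a` and its coordinates -/

/-- The entries of `U(g_t) = ½(Z + Zᴴ)` are differentiable. [folklore] -/
theorem differentiable_re_entry {g X : Matrix (Fin 2 ⊕ Fin 2) (Fin 2 ⊕ Fin 2) ℂ} (hg : gᴴ * Matrix.J (Fin 2) ℂ * g = Matrix.J (Fin 2) ℂ)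
    (hX : Xᴴ * Matrix.J (Fin 2) ℂ + Matrix.J (Fin 2) ℂ * X = 0) (i j : Fin 2) :
    Differentiable ℝ (fun t : ℝ => ((2 : ℂ)⁻¹ • (moeb (g * NormedSpace.exp (t • X)) (I • (1 : Matrix (Fin 2) (Fin 2) ℂ)) +
      (moeb (g * NormedSpace.exp (t • X)) (I • (1 : Matrix (Fin 2) (Fin 2) ℂ)))ᴴ)) i j) := by
  simp_rw [Matrix.smul_apply, Matrix.add_apply, smul_eq_mul]
  exact (differentiable_const _).mul ((differentiable_moeb_entry hg hX i j).add (differentiable_moeb_conjTranspose_entry hg hX i j))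

/-- The entries of `V(g_t) = (2i)⁻¹(Z − Zᴴ)` are differentiable. [folklore] -/
theorem differentiable_im_entry {g X : Matrix (Fin 2 ⊕ Fin 2) (Fin 2 ⊕ Fin 2) ℂ} (hg : gᴴ * Matrix.J (Fin 2) ℂ * g = Matrix.J (Fin 2) ℂ)
    (hX : Xᴴ * Matrix.J (Fin 2) ℂ + Matrix.J (Fin 2) ℂ * X = 0) (i j : Fin 2) :
    Differentiable ℝ (fun t : ℝ => ((2 * I)⁻¹ • (moeb (g * NormedSpace.exp (t • X)) (I • (1 : Matrix (Fin 2) (Fin 2) ℂ)) -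
      (moeb (g * NormedSpace.exp (t • X)) (I • (1 : Matrix (Fin 2) (Fin 2) ℂ)))ᴴ)) i j) := by
  simp_rw [Matrix.smul_apply, Matrix.sub_apply, smul_eq_mul]
  exact (differentiable_const _).mul ((differentiable_moeb_entry hg hX i j).sub (differentiable_moeb_conjTranspose_entry hg hX i j))

/-- The entries of the weight `aᴴ(2V(g_t))a` are differentiable. [folklore] -/
theorem differentiable_weight_entry {g X : Matrix (Fin 2 ⊕ Fin 2) (Fin 2 ⊕ Fin 2) ℂ} (hg : gᴴ * Matrix.J (Fin 2) ℂ * g = Matrix.J (Fin 2) ℂ)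
    (hX : Xᴴ * Matrix.J (Fin 2) ℂ + Matrix.J (Fin 2) ℂ * X = 0) (a : Matrix (Fin 2) (Fin 2) ℂ) (i j : Fin 2) :
    Differentiable ℝ (fun t : ℝ => (aᴴ * ((2 : ℂ) • ((2 * I)⁻¹ • (moeb (g * NormedSpace.exp (t • X)) (I • (1 : Matrix (Fin 2) (Fin 2) ℂ)) -
      (moeb (g * NormedSpace.exp (t • X)) (I • (1 : Matrix (Fin 2) (Fin 2) ℂ)))ᴴ))) * a) i j) := by
  have h : ∀ t : ℝ, (aᴴ * ((2 : ℂ) • ((2 * I)⁻¹ • (moeb (g * NormedSpace.exp (t • X)) (I • (1 : Matrix (Fin 2) (Fin 2) ℂ)) -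
      (moeb (g * NormedSpace.exp (t • X)) (I • (1 : Matrix (Fin 2) (Fin 2) ℂ)))ᴴ))) * a) i j =
      ∑ r, (∑ q, aᴴ i q * ((2 : ℂ) * ((2 * I)⁻¹ • (moeb (g * NormedSpace.exp (t • X)) (I • (1 : Matrix (Fin 2) (Fin 2) ℂ)) -
        (moeb (g * NormedSpace.exp (t • X)) (I • (1 : Matrix (Fin 2) (Fin 2) ℂ)))ᴴ)) q r)) * a r j := by
    intro t
    rw [Matrix.mul_apply]
    refine Finset.sum_congr rfl fun r _ => ?_
    rw [Matrix.mul_apply]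
    simp only [Matrix.smul_apply, smul_eq_mul]
  simp_rw [h]
  exact Differentiable.fun_sum fun r _ => (Differentiable.fun_sum fun q _ =>
    (differentiable_const _).mul ((differentiable_const _).mul (differentiable_im_entry hg hX q r))).mul (differentiable_const _)

/-- The coordinate `p(g_t) = (aᴴ(2V)a)₀₀.re` is differentiable. [folklore] -/
theorem differentiable_p {g X : Matrix (Fin 2 ⊕ Fin 2) (Fin 2 ⊕ Fin 2) ℂ} (hg : gᴴ * Matrix.J (Fin 2) ℂ * g = Matrix.J (Fin 2) ℂ)
    (hX : Xᴴ * Matrix.J (Fin 2) ℂ + Matrix.J (Fin 2) ℂ * X = 0) (a : Matrix (Fin 2) (Fin 2) ℂ) :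
    Differentiable ℝ (fun t : ℝ => ((aᴴ * ((2 : ℂ) • ((2 * I)⁻¹ • (moeb (g * NormedSpace.exp (t • X)) (I • (1 : Matrix (Fin 2) (Fin 2) ℂ)) -
      (moeb (g * NormedSpace.exp (t • X)) (I • (1 : Matrix (Fin 2) (Fin 2) ℂ)))ᴴ))) * a) 0 0).re) :=
  (Complex.reCLM.differentiable).comp (differentiable_weight_entry hg hX a 0 0)

/-- The coordinate `q(g_t) = (aᴴ(2V)a)₁₁.re` is differentiable. [folklore] -/
theorem differentiable_q {g X : Matrix (Fin 2 ⊕ Fin 2) (Fin 2 ⊕ Fin 2) ℂ} (hg : gᴴ * Matrix.J (Fin 2) ℂ * g = Matrix.J (Fin 2) ℂ)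
    (hX : Xᴴ * Matrix.J (Fin 2) ℂ + Matrix.J (Fin 2) ℂ * X = 0) (a : Matrix (Fin 2) (Fin 2) ℂ) :
    Differentiable ℝ (fun t : ℝ => ((aᴴ * ((2 : ℂ) • ((2 * I)⁻¹ • (moeb (g * NormedSpace.exp (t • X)) (I • (1 : Matrix (Fin 2) (Fin 2) ℂ)) -
      (moeb (g * NormedSpace.exp (t • X)) (I • (1 : Matrix (Fin 2) (Fin 2) ℂ)))ᴴ))) * a) 1 1).re) :=
  (Complex.reCLM.differentiable).comp (differentiable_weight_entry hg hX a 1 1)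

/-- `|w(g_t)|²` (`w = (aᴴ(2V)a)₀₁`) is differentiable. [folklore] -/
theorem differentiable_normSq_w {g X : Matrix (Fin 2 ⊕ Fin 2) (Fin 2 ⊕ Fin 2) ℂ} (hg : gᴴ * Matrix.J (Fin 2) ℂ * g = Matrix.J (Fin 2) ℂ)
    (hX : Xᴴ * Matrix.J (Fin 2) ℂ + Matrix.J (Fin 2) ℂ * X = 0) (a : Matrix (Fin 2) (Fin 2) ℂ) :
    Differentiable ℝ (fun t : ℝ => normSq ((aᴴ * ((2 : ℂ) • ((2 * I)⁻¹ • (moeb (g * NormedSpace.exp (t • X)) (I • (1 : Matrix (Fin 2) (Fin 2) ℂ)) -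
      (moeb (g * NormedSpace.exp (t • X)) (I • (1 : Matrix (Fin 2) (Fin 2) ℂ)))ᴴ))) * a) 0 1)) := by
  have hw := differentiable_weight_entry hg hX a 0 1
  simp_rw [Complex.normSq_apply]
  exact (((Complex.reCLM.differentiable).comp hw).mul ((Complex.reCLM.differentiable).comp hw)).add
    (((Complex.imCLM.differentiable).comp hw).mul ((Complex.imCLM.differentiable).comp hw))

/-- **The weight is positive definite along the ray**, so `p(g_t) > 0` and `|w|² < p q`. [folklore] -/
theorem weight_coords_pos {g X : Matrix (Fin 2 ⊕ Fin 2) (Fin 2 ⊕ Fin 2) ℂ} (hg : gᴴ * Matrix.J (Fin 2) ℂ * g = Matrix.J (Fin 2) ℂ)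
    (hX : Xᴴ * Matrix.J (Fin 2) ℂ + Matrix.J (Fin 2) ℂ * X = 0) {a : Matrix (Fin 2) (Fin 2) ℂ} (ha : IsUnit a) (t : ℝ) :
    0 < ((aᴴ * ((2 : ℂ) • ((2 * I)⁻¹ • (moeb (g * NormedSpace.exp (t • X)) (I • (1 : Matrix (Fin 2) (Fin 2) ℂ)) -
      (moeb (g * NormedSpace.exp (t • X)) (I • (1 : Matrix (Fin 2) (Fin 2) ℂ)))ᴴ))) * a) 0 0).re ∧
    normSq ((aᴴ * ((2 : ℂ) • ((2 * I)⁻¹ • (moeb (g * NormedSpace.exp (t • X)) (I • (1 : Matrix (Fin 2) (Fin 2) ℂ)) -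
      (moeb (g * NormedSpace.exp (t • X)) (I • (1 : Matrix (Fin 2) (Fin 2) ℂ)))ᴴ))) * a) 0 1) <
      ((aᴴ * ((2 : ℂ) • ((2 * I)⁻¹ • (moeb (g * NormedSpace.exp (t • X)) (I • (1 : Matrix (Fin 2) (Fin 2) ℂ)) -
        (moeb (g * NormedSpace.exp (t • X)) (I • (1 : Matrix (Fin 2) (Fin 2) ℂ)))ᴴ))) * a) 0 0).re *
      ((aᴴ * ((2 : ℂ) • ((2 * I)⁻¹ • (moeb (g * NormedSpace.exp (t • X)) (I • (1 : Matrix (Fin 2) (Fin 2) ℂ)) -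
        (moeb (g * NormedSpace.exp (t • X)) (I • (1 : Matrix (Fin 2) (Fin 2) ℂ)))ᴴ))) * a) 1 1).re := by
  set V : Matrix (Fin 2) (Fin 2) ℂ := (2 * I)⁻¹ • (moeb (g * NormedSpace.exp (t • X)) (I • (1 : Matrix (Fin 2) (Fin 2) ℂ)) -
      (moeb (g * NormedSpace.exp (t • X)) (I • (1 : Matrix (Fin 2) (Fin 2) ℂ)))ᴴ) with hV
  have hVpos : V.PosDef := posDef_im_moeb (mul_mem_UJ hg (conjTranspose_exp_mul_J_mul_exp hX t)) posDef_im_I_smul_one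
  have h2V : ((2 : ℂ) • V).PosDef := by
    have h := hVpos.smul (by norm_num : (0 : ℝ) < 2)
    rwa [show ((2 : ℝ) • V) = ((2 : ℂ) • V) by rw [← Complex.coe_smul]; norm_num] at h
  have hg' : (aᴴ * ((2 : ℂ) • V) * a).PosDef := by
    have := Matrix.IsUnit.posDef_star_left_conjugate_iff (x := (2 : ℂ) • V) ha
    rw [Matrix.star_eq_conjTranspose] at this
    exact this.mpr h2V
  have he := hermTwo_eq_of_isHermitian hg'.1
  have hg'' : (hermTwo (((aᴴ * ((2 : ℂ) • V) * a) 0 0).re, (aᴴ * ((2 : ℂ) • V) * a) 0 1, ((aᴴ * ((2 : ℂ) • V) * a) 1 1).re)).PosDef := by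
    rw [he]; exact hg'
  have h := (posDef_hermTwo_iff _).mp hg''
  simp only at h
  exact h

/-- `q′(g_t) = q − |w|²/p` is differentiable (`p > 0` along the ray). [folklore] -/
theorem differentiable_q' {g X : Matrix (Fin 2 ⊕ Fin 2) (Fin 2 ⊕ Fin 2) ℂ} (hg : gᴴ * Matrix.J (Fin 2) ℂ * g = Matrix.J (Fin 2) ℂ)
    (hX : Xᴴ * Matrix.J (Fin 2) ℂ + Matrix.J (Fin 2) ℂ * X = 0) {a : Matrix (Fin 2) (Fin 2) ℂ} (ha : IsUnit a) :
    Differentiable ℝ (fun t : ℝ =>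
      ((aᴴ * ((2 : ℂ) • ((2 * I)⁻¹ • (moeb (g * NormedSpace.exp (t • X)) (I • (1 : Matrix (Fin 2) (Fin 2) ℂ)) -
        (moeb (g * NormedSpace.exp (t • X)) (I • (1 : Matrix (Fin 2) (Fin 2) ℂ)))ᴴ))) * a) 1 1).re -
      normSq ((aᴴ * ((2 : ℂ) • ((2 * I)⁻¹ • (moeb (g * NormedSpace.exp (t • X)) (I • (1 : Matrix (Fin 2) (Fin 2) ℂ)) -
        (moeb (g * NormedSpace.exp (t • X)) (I • (1 : Matrix (Fin 2) (Fin 2) ℂ)))ᴴ))) * a) 0 1) /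
      ((aᴴ * ((2 : ℂ) • ((2 * I)⁻¹ • (moeb (g * NormedSpace.exp (t • X)) (I • (1 : Matrix (Fin 2) (Fin 2) ℂ)) -
        (moeb (g * NormedSpace.exp (t • X)) (I • (1 : Matrix (Fin 2) (Fin 2) ℂ)))ᴴ))) * a) 0 0).re) :=
  (differentiable_q hg hX a).sub ((differentiable_normSq_w hg hX a).div (differentiable_p hg hX a) fun t => (weight_coords_pos hg hX ha t).1.ne')

/-! ## §3 `‖det d(g_t)‖` -/

/-- `‖det denom (g_t) (i1)‖` is differentiable (the determinant never vanishes along the ray). [Shimura1997, §5.6] -/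
theorem differentiable_norm_det_denom {g X : Matrix (Fin 2 ⊕ Fin 2) (Fin 2 ⊕ Fin 2) ℂ} (hg : gᴴ * Matrix.J (Fin 2) ℂ * g = Matrix.J (Fin 2) ℂ)
    (hX : Xᴴ * Matrix.J (Fin 2) ℂ + Matrix.J (Fin 2) ℂ * X = 0) :
    Differentiable ℝ (fun t : ℝ => ‖(denom (g * NormedSpace.exp (t • X)) (I • (1 : Matrix (Fin 2) (Fin 2) ℂ))).det‖) :=
  fun t => (differentiable_det_denom g X t).norm ℝ (det_denom_mul_exp_ne_zero hg hX t)

/-! ## §4 The bundle for FILE 2's product rule -/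

/-- **RAY CALCULUS OF THE POINT DATA** (`g ∈ U(J)`, `X ∈ 𝔲(J)`, `a` invertible): along `t ↦ g·exp(tX)` the four `s`-carrying point data of the
explicit scalar-type arch letter — `‖det d‖` (≠ 0), the entries of `U`, the weight coordinates `p` (> 0) and `q′` (> 0) — are `Differentiable ℝ` on `ℝ`.
[Knapp1986, Ch. VIII §3] [Shimura1997, §16.4] -/
theorem differentiable_pointData_mul_exp {g X : Matrix (Fin 2 ⊕ Fin 2) (Fin 2 ⊕ Fin 2) ℂ} (hg : gᴴ * Matrix.J (Fin 2) ℂ * g = Matrix.J (Fin 2) ℂ)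
    (hX : Xᴴ * Matrix.J (Fin 2) ℂ + Matrix.J (Fin 2) ℂ * X = 0) {a : Matrix (Fin 2) (Fin 2) ℂ} (ha : IsUnit a) :
    (∀ t : ℝ, (denom (g * NormedSpace.exp (t • X)) (I • (1 : Matrix (Fin 2) (Fin 2) ℂ))).det ≠ 0) ∧
    Differentiable ℝ (fun t : ℝ => ‖(denom (g * NormedSpace.exp (t • X)) (I • (1 : Matrix (Fin 2) (Fin 2) ℂ))).det‖) ∧
    (∀ i j : Fin 2, Differentiable ℝ (fun t : ℝ => ((2 : ℂ)⁻¹ • (moeb (g * NormedSpace.exp (t • X)) (I • (1 : Matrix (Fin 2) (Fin 2) ℂ)) +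
      (moeb (g * NormedSpace.exp (t • X)) (I • (1 : Matrix (Fin 2) (Fin 2) ℂ)))ᴴ)) i j)) ∧
    Differentiable ℝ (fun t : ℝ => ((aᴴ * ((2 : ℂ) • ((2 * I)⁻¹ • (moeb (g * NormedSpace.exp (t • X)) (I • (1 : Matrix (Fin 2) (Fin 2) ℂ)) -
      (moeb (g * NormedSpace.exp (t • X)) (I • (1 : Matrix (Fin 2) (Fin 2) ℂ)))ᴴ))) * a) 0 0).re) ∧
    (∀ t : ℝ, 0 < ((aᴴ * ((2 : ℂ) • ((2 * I)⁻¹ • (moeb (g * NormedSpace.exp (t • X)) (I • (1 : Matrix (Fin 2) (Fin 2) ℂ)) -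
      (moeb (g * NormedSpace.exp (t • X)) (I • (1 : Matrix (Fin 2) (Fin 2) ℂ)))ᴴ))) * a) 0 0).re) ∧
    Differentiable ℝ (fun t : ℝ =>
      ((aᴴ * ((2 : ℂ) • ((2 * I)⁻¹ • (moeb (g * NormedSpace.exp (t • X)) (I • (1 : Matrix (Fin 2) (Fin 2) ℂ)) -
        (moeb (g * NormedSpace.exp (t • X)) (I • (1 : Matrix (Fin 2) (Fin 2) ℂ)))ᴴ))) * a) 1 1).re -
      normSq ((aᴴ * ((2 : ℂ) • ((2 * I)⁻¹ • (moeb (g * NormedSpace.exp (t • X)) (I • (1 : Matrix (Fin 2) (Fin 2) ℂ)) -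
        (moeb (g * NormedSpace.exp (t • X)) (I • (1 : Matrix (Fin 2) (Fin 2) ℂ)))ᴴ))) * a) 0 1) /
      ((aᴴ * ((2 : ℂ) • ((2 * I)⁻¹ • (moeb (g * NormedSpace.exp (t • X)) (I • (1 : Matrix (Fin 2) (Fin 2) ℂ)) -
        (moeb (g * NormedSpace.exp (t • X)) (I • (1 : Matrix (Fin 2) (Fin 2) ℂ)))ᴴ))) * a) 0 0).re) ∧
    (∀ t : ℝ, 0 < ((aᴴ * ((2 : ℂ) • ((2 * I)⁻¹ • (moeb (g * NormedSpace.exp (t • X)) (I • (1 : Matrix (Fin 2) (Fin 2) ℂ)) -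
        (moeb (g * NormedSpace.exp (t • X)) (I • (1 : Matrix (Fin 2) (Fin 2) ℂ)))ᴴ))) * a) 1 1).re -
      normSq ((aᴴ * ((2 : ℂ) • ((2 * I)⁻¹ • (moeb (g * NormedSpace.exp (t • X)) (I • (1 : Matrix (Fin 2) (Fin 2) ℂ)) -
        (moeb (g * NormedSpace.exp (t • X)) (I • (1 : Matrix (Fin 2) (Fin 2) ℂ)))ᴴ))) * a) 0 1) /
      ((aᴴ * ((2 : ℂ) • ((2 * I)⁻¹ • (moeb (g * NormedSpace.exp (t • X)) (I • (1 : Matrix (Fin 2) (Fin 2) ℂ)) -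
        (moeb (g * NormedSpace.exp (t • X)) (I • (1 : Matrix (Fin 2) (Fin 2) ℂ)))ᴴ))) * a) 0 0).re) := by
  refine ⟨det_denom_mul_exp_ne_zero hg hX, differentiable_norm_det_denom hg hX, differentiable_re_entry hg hX,
    differentiable_p hg hX a, fun t => (weight_coords_pos hg hX ha t).1, differentiable_q' hg hX ha, fun t => ?_⟩
  obtain ⟨hp, hpq⟩ := weight_coords_pos hg hX ha t
  rw [sub_pos, div_lt_iff₀ hp]
  linarith

end Summit.HodgeConjecture.HodgeConjecture.Cruxes.HLiu418.K2LiuArchPointRayCalculus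

end
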